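import Literature.NumberTheory.EllipticCurves.PrimaryTorsionLocalGoodReductionFrobeniusProofs
import Literature.NumberTheory.GaloisRepresentations.LocalHOneInertiaRestrictionProfinite
import HarnessLib

/-!
# `H¹(K_w, E[p^∞]) ↪ H¹(I_w, E[p^∞])` at a place `w ∤ p` of good reduction (`ℋ^ur_w(E[p^∞]) = 0`)
# — PROVED

Topic `NumberTheory/EllipticCurves`; namespace `WeierstrassCurve`. THEOREMS ONLY (no definition, no
named fact, no instance, no `sorry`; D-0026). Cell `bsd-stepL` (typer lane `defn-ty1`, g9): the
inflation–restriction half of module L4a ("`#H¹(K_w, E[p^∞]) = #E(K_w)[p^∞]` at a good `w ∤ p`",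
[GreenbergLNM1716] §2; [Castella2018] Prop. 2.5) of the discharge plan for the named LOCAL fact
`JetchevSkinnerWan2017.sigmaLocal_charIdeal_eulerFactor_mem_of_noTamagawaDefect`
(`HOME/defn-ty1/g9/NOTE-sigmaLocal-discharge-plan-defn-ty1-g9.md`).

In the exact sequence `0 → H¹(Γ_{K_w}/I_w, A^{I_w}) → H¹(K_w, A) → H¹(I_w, A)^{Γ_{K_w}/I_w}` for the
discrete module `A = E[p^∞]` at a good place `w ∤ p`, `A^{I_w} = A` (unramified, Silverman VII.4.1(b))
and `H¹(Γ_{K_w}/I_w, A) = A/(Frob_w − 1)A = 0` because `Frob_w − 1` is ONTO `A` (Cayley–Hamilton with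
`det(Frob_w − 1 | T_pE) = #Ẽ_w(k_w) ≠ 0`): so restriction to inertia is INJECTIVE on `H¹(K_w, E[p^∞])`
— Greenberg's "`H¹(K_v^{unr}/K_v, E[p^∞]) = 0` for `v ∤ p` of good reduction", Castella's
"`ℋ^ur_v` vanishes".

## What is proved

* `resSubgroup_absInertia_injective_of_sub_self_surjective` (generic): for a continuous representation
  `ρ` of `Γ_K` on a discrete module `M`, a finite place `w` and an arithmetic Frobenius lift
  `φ ∈ Γ_{K_w}`: if `I_{K_w}` (through `localMap K (Sum.inr w)`) acts trivially on `M` and `ρ(φ) − 1`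
  is onto, then `res : H¹(Γ_{K_w}, M) → H¹(I_{K_w}, M)` is injective (the tree's unramified-class
  criterion `oneCocycleClass_eq_zero_iff_of_vanishing_absInertia`, [SerreLocalFields1979] XIII §1
  Prop. 1, applied to LOCAL classes; the tree's `Castella2018.resH1_localMap_inl_eq_zero_of_inr` is
  the same mechanism for classes restricted from `Γ_K`);
* **`resSubgroup_absInertia_injective_primaryTorsion`** — for an elliptic curve `W/K`, a prime `p` and
  a finite place `w ∤ p` of GOOD reduction: `H¹(K_w, E[p^∞]) → H¹(I_{K_w}, E[p^∞])` is injective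
  (inputs `primaryTorsionGaloisRep_localMap_inr_apply`,
  `primaryTorsionGaloisRep_sub_self_surjective_of_isFrobPow` of
  `PrimaryTorsionLocalGoodReductionFrobeniusProofs`).

HONEST FRAMING: the order of `H¹(K_w, E[p^∞])` is NOT computed here (it remains to bound the image
`H¹(I_w, E[p^∞])^{Frob} = E[p^∞](−1)^{Frob = 1}` by `#E(K_w)[p^∞]`, the tame-inertia and Weil-pairing
half of L4a); the named fact is NOT discharged by this file.

References: [SerreLocalFields1979] XIII §1 Prop. 1; [GreenbergLNM1716] §2 (pp. 69–71); [Castella2018]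
§2.2 and Prop. 2.5; [Rubin2000] Lemma 1.3.2; [SilvermanAEC2009] VII.4.1(b), C.21.3. Tree:
`LocalHOneInertiaRestrictionProfinite` (`exists_rep_vanishing_absInertia_of_resSubgroup_eq_zero`,
`oneCocycleClass_eq_zero_iff_of_vanishing_absInertia`), `PrimaryTorsionLocalGoodReductionFrobeniusProofs`,
`PrimaryTorsionFrobeniusUnramifiedProofs` (`exists_isFrobPow_one_adicCompletion`).
-/

noncomputable section

open scoped Classical
open CategoryTheory Field NumberField IsDedekindDomain IsDedekindDomain.HeightOneSpectrum
open Literature.NumberTheory.EllipticCurves Literature.NumberTheory.EllipticCurves.BigGaloisRep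
  Literature.NumberTheory.GaloisRepresentations

/-! ## §1 Generic: trivial inertia action + `Frob − 1` onto ⟹ restriction to inertia is injective -/

namespace Literature.NumberTheory.EllipticCurves

variable {K : Type} [Field K] [NumberField K]
variable {A : Type} [CommRing A] [TopologicalSpace A]
variable {M : Type} [AddCommGroup M] [Module A M] [TopologicalSpace M] [DiscreteTopology M]
  [ContinuousSMul A M]

/-- **`ker(H¹(K_w, M) → H¹(I_{K_w}, M)) = 0` when `I_{K_w}` acts trivially and `Frob_w − 1` is onto.**
For a continuous representation `ρ` of `Γ_K` on a discrete `M`, a finite place `w` (restricted to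
`Γ_{K_w}` along `localMap K (Sum.inl w)`), and an arithmetic Frobenius lift `φ ∈ Γ_{K_w}`: if every
element of the local inertia group (through `localMap K (Sum.inr w)`) acts as the identity on `M` and
`ρ(φ) − 1 : M → M` is surjective, then restriction `H¹(Γ_{K_w}, M) → H¹(I_{K_w}, M)` is injective: a
class dying on `I_{K_w}` has an `I_{K_w}`-vanishing representative `z`, and `[z] = 0` iff
`z(φ) ∈ (ρ(φ) − 1)M^{I} = M` (the tree's `oneCocycleClass_eq_zero_iff_of_vanishing_absInertia`).
[cite: SerreLocalFields1979, XIII §1 Prop. 1] [cite: Castella2018, §2.2 ("ℋ^ur_v vanishes")] -/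
theorem resSubgroup_absInertia_injective_of_sub_self_surjective
    (ρ : ContinuousRep (absoluteGaloisGroup K) A M) (w : HeightOneSpectrum (𝓞 K))
    (hI : ∀ (σ : LocalGroup K (Sum.inr w)) (m : M), ρ (localMap K (Sum.inr w) σ) m = m)
    {φ : absoluteGaloisGroup (w.adicCompletion K)} (hφ : IsFrobPow φ 1)
    (hsurj : Function.Surjective fun m : M ↦ ρ (localMap K (Sum.inl w) φ) m - m) :
    Function.Injective
      (resSubgroup (ρ.restrict (localMap K (Sum.inl w))).toTopRep (absInertia (w.adicCompletion K)) 1) := by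
  set X := (ρ.restrict (localMap K (Sum.inl w))).toTopRep with hX
  have hXc : Continuous fun q : absoluteGaloisGroup (w.adicCompletion K) × X ↦ X.ρ q.1 q.2 :=
    (ρ.restrict (localMap K (Sum.inl w))).continuous_apply₂
  -- kernel is zero
  have hker : ∀ c : continuousCohomology 1 X,
      resSubgroup X (absInertia (w.adicCompletion K)) 1 c = 0 → c = 0 := by
    intro c hc
    obtain ⟨z, rfl, hz, -⟩ :=
      exists_rep_vanishing_absInertia_of_resSubgroup_eq_zero (w.adicCompletion K) X hXc c hc
    refine (oneCocycleClass_eq_zero_iff_of_vanishing_absInertia (w.adicCompletion K) X hXc hφ z hz).2 ?_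
    obtain ⟨m, hm⟩ := hsurj (z.1 φ)
    exact ⟨m, fun n ↦ hI n m, hm.symm⟩
  intro a b hab
  rw [← sub_eq_zero]
  refine hker (a - b) ?_
  rw [map_sub, hab, sub_self]

end Literature.NumberTheory.EllipticCurves

/-! ## §2 `E[p^∞]` at a good place `w ∤ p` -/

namespace WeierstrassCurve

variable {K : Type} [Field K] [NumberField K] (W : WeierstrassCurve K) [W.IsElliptic]
  (p : ℕ) [Fact p.Prime] {w : HeightOneSpectrum (𝓞 K)}

/-- **`H¹(K_w, E[p^∞]) ↪ H¹(I_{K_w}, E[p^∞])` at a place `w ∤ p` of good reduction** ("`ℋ^ur_w(E[p^∞])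
= H¹(K_w^{unr}/K_w, E[p^∞]) = 0`"): for an elliptic curve `W` over a number field `K`, a prime `p`, a
finite place `w ∤ p` of good reduction, and any topology-compatible `ℤ_p`-structure on
`E[p^∞] = PrimaryTorsion (geomPoints W) p`, restriction of continuous cohomology classes from
`Γ_{K_w}` (acting through `localMap K (Sum.inl w)`) to the inertia group `absInertia K_w` is
injective — `I_{K_w}` acts trivially (`primaryTorsionGaloisRep_localMap_inr_apply`, VII.4.1(b)) and
`Frob_w − 1` is onto `E[p^∞]` (`primaryTorsionGaloisRep_sub_self_surjective_of_isFrobPow`,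
Cayley–Hamilton with `#Ẽ_w(k_w) ≠ 0`).
[cite: GreenbergLNM1716, §2 (p. 70, H¹(K_v^{unr}/K_v, E[p^∞]) = 0 for v ∤ p of good reduction)]
[cite: Castella2018, §2.2 ("ℋ^ur_v vanishes") and Prop. 2.5] [cite: SerreLocalFields1979, XIII §1 Prop. 1] -/
theorem resSubgroup_absInertia_injective_primaryTorsion (hw : ((p : ℕ) : 𝓞 K) ∉ w.asIdeal)
    (hgood : W.HasGoodReductionAt w) [ContinuousSMul ℤ_[p] (PrimaryTorsion (geomPoints W) p)] :
    Function.Injective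
      (resSubgroup ((W.primaryTorsionGaloisRep p).restrict (localMap K (Sum.inl w))).toTopRep
        (absInertia (w.adicCompletion K)) 1) := by
  obtain ⟨φ, hφ⟩ := WeierstrassCurve.exists_isFrobPow_one_adicCompletion (K := K) w
  exact resSubgroup_absInertia_injective_of_sub_self_surjective (W.primaryTorsionGaloisRep p) w
    (fun σ P ↦ W.primaryTorsionGaloisRep_localMap_inr_apply p hgood hw σ P) hφ
    (W.primaryTorsionGaloisRep_sub_self_surjective_of_isFrobPow p hw hgood hφ)

end WeierstrassCurve

end
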